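import Summits.HodgeConjecture.HodgeConjecture.Theorems.F0LD1ThetaArchLadderCore
import Summits.HodgeConjecture.HodgeConjecture.Theorems.F0LD1ThetaArchLadderWrongType
import Summits.HodgeConjecture.HodgeConjecture.Theorems.F0LD1ThetaArchLadderSigns
import Summits.HodgeConjecture.HodgeConjecture.Theorems.F0LD1ThetaDichotomyBricks
import HarnessLib

-- statements over the theta-kernel datum elaborate to very large types; elaborate sequentially (as in the ★ kit lineage)
set_option Elab.async false

/-!
# (Gα-C∞) THE BRICK `ArchLadder` FROM THE ι-PLACE MOVES (line LD1 of crux HLiu418; LD1-plan (g2) DEALS #9-bis; owner A-p16 (g35))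

Cell hodgecm-mathlib, floor 0; namespace `Summit.HodgeConjecture.HodgeConjecture.Cruxes.HLiu418.F0LD1ThetaArchLadder`; `--supports stmt-HodgeConjecture-24832 --as helper`.
THEOREMS ONLY (no definition, no instance, no notation, no `sorry`).

**`archLadder_of_iotaStep`** — `F0LD1ThetaDichotomyBricks.ArchLadder` (★ statement file) follows from the two MOVES AT THE PLACE OF `ι` (the hypothesis, over LITERALLY
the brick's binder prefix: for the mixed real place `v₀` under `ι`, a positive coordinate `kp` and a non-positive one `km`, `[θ_{h_β ⊗ Φ_f}] ∈ Q` implies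
`[θ_{h_{β + e_{kp} + e_{km}} ⊗ Φ_f}] ∈ Q` and, when both exponents are positive, `[θ_{h_{β − e_{kp} − e_{km}} ⊗ Φ_f}] ∈ Q` — LD1-p02 (g4)'s (P4) `iotaStep`,
[KashiwaraVergne1978, §6]: the `U(1,1)`-ladder inside one `U(W)_ι`-type).  Everything else is ★: the ladder core ★ `F0LD1ThetaArchLadderCore` ((P5-comb) ★
`F0LD1ArchLadderReachability` + (P2c) ★ `F0LD1ThetaArchDefiniteTransitivity` over (P1)∕(P1⁻) ★ `F0LD1ThetaArchCompactStep(Neg)`), the wrong-type vanishing (P3) ★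
`F0LD1ThetaArchLadderWrongType`, the sign frame (σ1)∕(σ2)∕`hcov` ★ `F0LD1ThetaArchLadderSigns`; the brick prefix is unpacked as in ★ `torusProjector`
(compactness of `[U(H)]`, the continuity∕range datum `hT` of the pinned transport, Borel data on `[U(W)]`).  The final `archLadder_holds : ArchLadder` is
`archLadder_of_iotaStep iotaStep` once (P4) is ★.
Nothing printed is discharged; HC_CM is proved only modulo the 7 printed citations (2 remaining: hLiu418 = stmt-HodgeConjecture-24832, h413 =
stmt-HodgeConjecture-24833) until rung 0 closes; count-neutral.

References (prose locators): Kashiwara–Vergne 1978 §6 (6.3), §7 (7.2); Howe 1989 §3; Folland 1989 Ch. 4 §5, Thm. (4.37); Konno–Konno 2007 Thm. 5.4.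
-/

set_option autoImplicit false
set_option linter.dupNamespace false

noncomputable section

open NumberField NumberField.InfinitePlace MeasureTheory IsDedekindDomain
open scoped Matrix Kronecker ComplexOrder ENNReal TensorProduct SchwartzMap InnerProductSpace ComplexConjugate Classical
open Literature.NumberTheory.Automorphic Literature.NumberTheory.Automorphic.UnitaryGroup
open Literature.NumberTheory.Automorphic.UnitaryGroup.CotangentForms (toQuotFun)
open Literature.NumberTheory.Automorphic.UnitaryCurveForms
open Literature.NumberTheory.Automorphic.Liu2021 Literature.NumberTheory.Automorphic.Liu2021.Def411WeilCarriers
open Literature.NumberTheory.Automorphic.Liu2021.Def411WeilCarriersDoubling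
open Literature.NumberTheory.Automorphic.Liu2021.CinfThetaTorus
open Literature.NumberTheory.GaloisRepresentations Literature.NumberTheory.Automorphic.IdeleClassGroup
open Literature.NumberTheory.GelbartRogawski1991 Literature.NumberTheory.GelbartRogawski1991.UnitaryDualPair
open Literature.NumberTheory.GelbartRogawski1991.UnitaryDualPair.WeilCoinv
open Literature.NumberTheory.GelbartRogawski1991.GRConstruction
open Literature.NumberTheory.Weil1964
open Literature.RepresentationTheory.Liu2021 Literature.RepresentationTheory.HarrisKudlaSweet1996
open Literature.RepresentationTheory.HeisenbergGroup Literature.Analysis.SegalBargmann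
open Literature.RepresentationTheory.KonnoKonno2007 Literature.RepresentationTheory.KonnoKonno2007.RealDualPair
open Literature.RepresentationTheory.CompactGroups
open Literature.NumberTheory.Rogawski1990
open Summit.HodgeConjecture.HodgeConjecture.Cruxes.HLiu418.F0LD1ThetaTransportKit
open Summit.HodgeConjecture.HodgeConjecture.Cruxes.HLiu418.F0LD2ThetaTensorClasses
open Summit.HodgeConjecture.HodgeConjecture.Cruxes.HLiu418.F0LD2FrameTransportPin
open Summit.HodgeConjecture.HodgeConjecture.Cruxes.HLiu418.F0LD1ThetaGermDefs
open Summit.HodgeConjecture.HodgeConjecture.Cruxes.HLiu418.F0LD1ThetaDichotomyOfBricks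
open Summit.HodgeConjecture.HodgeConjecture.Cruxes.HLiu418.F0LD1ThetaArchLadderCore
open Summit.HodgeConjecture.HodgeConjecture.Cruxes.HLiu418.F0LD1ThetaArchLadderWrongType
open Summit.HodgeConjecture.HodgeConjecture.Cruxes.HLiu418.F0LD1ThetaArchLadderSigns

namespace Summit.HodgeConjecture.HodgeConjecture.Cruxes.HLiu418.F0LD1ThetaArchLadder

set_option maxHeartbeats 1600000 in
/-- **THE BRICK `ArchLadder` FROM THE TWO ι-PLACE MOVES.**  [cite: KashiwaraVergne1978, §6 (6.3), §7 (7.2)] [cite: Howe1989, §3] [cite: Folland1989, Ch. 4 §5] -/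
theorem archLadder_of_iotaStep
    (hι :   ∀ (L : Type) [Field L] [NumberField L] [IsCMField L] (ι : L →+* ℂ) (H : Matrix (Fin 2) (Fin 2) L)
      (dV : Fin 2 → L) (hdV : ∀ i, IsCMField.complexConj L (dV i) = dV i) (hdV0 : ∀ i, dV i ≠ 0)
      (t : L) (ht : t ≠ 0) (g : GL (Fin 2) L)
      (hg : formCongr ((IsCMField.complexConj L : L ≃ₐ[↥(maximalRealSubfield L)] L) : L →+* L) g (t • H) = Matrix.diagonal dV),
      (∃ T : GL (Fin 2) ℂ, formCongr (starRingEnd ℂ) T ((Matrix.diagonal dV).map ι) = Matrix.diagonal ![(1 : ℂ), -1]) →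
      ∀ (hdef : ∀ τ' : L →+* ℂ, InfinitePlace.mk τ' ≠ InfinitePlace.mk ι → ((Matrix.diagonal dV).map τ').PosDef)
        (hdeg : 4 ≤ Module.finrank ℚ L)
        (μ : Measure (adelicGroupData (↥(maximalRealSubfield L)) L (IsCMField.complexConj L) 2 H).automorphicQuotient)
        [(adelicGroupData (↥(maximalRealSubfield L)) L (IsCMField.complexConj L) 2 H).IsAutomorphicMeasure μ]
        {n' : ℕ} (e₁ : Fin 2 × Fin 1 ≃ Fin n')
        (lam : Literature.NumberTheory.Automorphic.IdeleClassGroup L →ₜ* Circle) (hlam : IsConjugateSymplectic L lam), HasWeight L lam 1 →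
      ∀ (ιA : (adelicGroupData (↥(maximalRealSubfield L)) L (IsCMField.complexConj L) 2 H).Adelic →*
          ↥(UnitaryGroup.adelic (↥(maximalRealSubfield L)) L (IsCMField.complexConj L) 2 (Matrix.diagonal dV)))
        (hιA : ∀ k, ((ιA k : ↥(UnitaryGroup.adelic (↥(maximalRealSubfield L)) L (IsCMField.complexConj L) 2 (Matrix.diagonal dV))) :
              GL (Fin 2) (AdeleRing (𝓞 L) L)) =
            (toAdeleGL L g)⁻¹ * adelicVal (↥(maximalRealSubfield L)) L (IsCMField.complexConj L) 2 H k * toAdeleGL L g)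
        [CompactSpace (↥(UnitaryGroup.adelic (↥(maximalRealSubfield L)) L (IsCMField.complexConj L) 2 (Matrix.diagonal dV)) ⧸
          (UnitaryGroup.toAdelic (↥(maximalRealSubfield L)) L (IsCMField.complexConj L) 2 (Matrix.diagonal dV)).range)]
        (a' : (↥(maximalRealSubfield L))ˣ)
        (ξ : haveI := normal_range_toAdelic_JW L a'
          PontryaginDual (↥(UnitaryGroup.adelic (↥(maximalRealSubfield L)) L (IsCMField.complexConj L) 1 (JW (↥(maximalRealSubfield L)) L a')) ⧸ (UnitaryGroup.toAdelic (↥(maximalRealSubfield L)) L (IsCMField.complexConj L) 1 (JW (↥(maximalRealSubfield L)) L a')).range)),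
        letI : MeasurableSpace (↥(UnitaryGroup.adelic (↥(maximalRealSubfield L)) L (IsCMField.complexConj L) 1 (JW (↥(maximalRealSubfield L)) L a')) ⧸ (UnitaryGroup.toAdelic (↥(maximalRealSubfield L)) L (IsCMField.complexConj L) 1 (JW (↥(maximalRealSubfield L)) L a')).range) := borel _
        haveI := normal_range_toAdelic_JW L a'
        haveI : CompactSpace (adelicGroupData (↥(maximalRealSubfield L)) L (IsCMField.complexConj L) 2 H).automorphicQuotient :=
          (UnitaryGroup.exists_infinitePlace_ne L hdeg ι).elim fun τ hτ =>
            UnitaryGroup.compactSpace_adelicGroupData_automorphicQuotient L 2 H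
              (UnitaryGroup.anisotropic_of_formCongr_smul_eq_of_posDef L 2 H dV t ht g hg τ (hdef τ hτ))
        haveI hT : Continuous ιA ∧ ∀ ⦃γ : (adelicGroupData (↥(maximalRealSubfield L)) L (IsCMField.complexConj L) 2 H).Adelic⦄,
            γ ∈ (UnitaryGroup.toAdelic (↥(maximalRealSubfield L)) L (IsCMField.complexConj L) 2 H).range →
              ιA γ ∈ (UnitaryGroup.toAdelic (↥(maximalRealSubfield L)) L (IsCMField.complexConj L) 2 (Matrix.diagonal dV)).range :=
          ⟨continuous_of_pin L 2 H dV g ιA hιA, fun _ hγ => mem_range_toAdelic_of_pin L 2 H dV t ht g hg ιA hιA hγ⟩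
        ∀ (hρ : HasThetaMajorants fun
          (p : ↥(UnitaryGroup.adelic (↥(maximalRealSubfield L)) L (IsCMField.complexConj L) 2 (Matrix.diagonal dV)) × ↥(UnitaryGroup.adelic (↥(maximalRealSubfield L)) L (IsCMField.complexConj L) 1 (JW (↥(maximalRealSubfield L)) L a'))) (Φ : piSchwartzBruhat (↥(maximalRealSubfield L)) (Fin n')) =>
            pairRep (↥(maximalRealSubfield L)) L (IsCMField.complexConj L) 2 1 e₁ (Matrix.diagonal dV) (JW (↥(maximalRealSubfield L)) L a')
              (chiSplittingLine L e₁ dV hdV hdV0 (toHeckeCharacter L lam) (isUnitary_toHeckeCharacter L lam)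
                ((isOscillatorChar_toHeckeCharacter_iff lam).mpr hlam) (TW (↥(maximalRealSubfield L)) a')
                (isUnit_det_TW (↥(maximalRealSubfield L)) a') (JW (↥(maximalRealSubfield L)) L a') (JW_eq (↥(maximalRealSubfield L)) L a'))
              p Φ)
        (μW : Measure (↥(UnitaryGroup.adelic (↥(maximalRealSubfield L)) L (IsCMField.complexConj L) 1 (JW (↥(maximalRealSubfield L)) L a')) ⧸ (UnitaryGroup.toAdelic (↥(maximalRealSubfield L)) L (IsCMField.complexConj L) 1 (JW (↥(maximalRealSubfield L)) L a')).range)) [IsFiniteMeasure μW] [SMulInvariantMeasure ↥(UnitaryGroup.adelic (↥(maximalRealSubfield L)) L (IsCMField.complexConj L) 1 (JW (↥(maximalRealSubfield L)) L a')) (↥(UnitaryGroup.adelic (↥(maximalRealSubfield L)) L (IsCMField.complexConj L) 1 (JW (↥(maximalRealSubfield L)) L a')) ⧸ (UnitaryGroup.toAdelic (↥(maximalRealSubfield L)) L (IsCMField.complexConj L) 1 (JW (↥(maximalRealSubfield L)) L a')).range) μW]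
        (Φf : FinSB (↥(maximalRealSubfield L)) (Fin n'))
        (v₀ : {v : InfinitePlace (↥(maximalRealSubfield L)) // v.IsReal})
        (hv₀ : (InfinitePlace.mk ι).comap (algebraMap (↥(maximalRealSubfield L)) L) = v₀.1) (kp km : Fin n')
        (hkp : 0 < signVec (cmPlaceOver L) (cmGramEntry L e₁ dV hdV (lineW L (TW (Fp L) a')) (complexConj_lineW L (TW (Fp L) a'))) (imagUnit L) v₀ kp)
        (hkm : ¬ 0 < signVec (cmPlaceOver L) (cmGramEntry L e₁ dV hdV (lineW L (TW (Fp L) a')) (complexConj_lineW L (TW (Fp L) a'))) (imagUnit L) v₀ km)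
        (Q : ContRepresentation.ClosedSubrep ((adelicGroupData (↥(maximalRealSubfield L)) L (IsCMField.complexConj L) 2 H).rightRegular μ))
        (β : ((Fin n' × {v : InfinitePlace (↥(maximalRealSubfield L)) // v.IsReal}) →₀ ℕ)),
          MemLp.toLp _ (memLp_toQuotFun_lineThetaLift L 2 H e₁ dV hdV hdV0 ιA hT lam hlam a' hρ μW
            (piSchwartzBruhatEquiv (↥(maximalRealSubfield L)) (Fin n') (follandHermite (frameV L e₁ dV hdV hdV0 (lineW L (TW (Fp L) a')) (complexConj_lineW L (TW (Fp L) a'))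
                (lineW_ne_zero L (TW (Fp L) a') (isUnit_det_TW (Fp L) a'))) β ⊗ₜ[ℂ] Φf)) (charCM ξ) μ 2) ∈ Q →
          MemLp.toLp _ (memLp_toQuotFun_lineThetaLift L 2 H e₁ dV hdV hdV0 ιA hT lam hlam a' hρ μW
            (piSchwartzBruhatEquiv (↥(maximalRealSubfield L)) (Fin n') (follandHermite (frameV L e₁ dV hdV hdV0 (lineW L (TW (Fp L) a')) (complexConj_lineW L (TW (Fp L) a'))
                (lineW_ne_zero L (TW (Fp L) a') (isUnit_det_TW (Fp L) a'))) (β + (Finsupp.single (kp, v₀) 1 + Finsupp.single (km, v₀) 1)) ⊗ₜ[ℂ] Φf)) (charCM ξ) μ 2) ∈ Q ∧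
          (0 < β (kp, v₀) → 0 < β (km, v₀) →
            MemLp.toLp _ (memLp_toQuotFun_lineThetaLift L 2 H e₁ dV hdV hdV0 ιA hT lam hlam a' hρ μW
            (piSchwartzBruhatEquiv (↥(maximalRealSubfield L)) (Fin n') (follandHermite (frameV L e₁ dV hdV hdV0 (lineW L (TW (Fp L) a')) (complexConj_lineW L (TW (Fp L) a'))
                (lineW_ne_zero L (TW (Fp L) a') (isUnit_det_TW (Fp L) a'))) (β - (Finsupp.single (kp, v₀) 1 + Finsupp.single (km, v₀) 1)) ⊗ₜ[ℂ] Φf)) (charCM ξ) μ 2) ∈ Q)) :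
    ArchLadder := by
  intro L _ _ _ ι H dV hdV hdV0 t ht g hg hsig hdef hdeg μ _ n' e₁ lam hlam hw ιA hpin _ a' ξ hρ μW _ _ β Φf hne Q hQ β'
  -- the brick prefix's inline data, as in ★ `torusProjector`: `[U(H)]` compact, the pinned transport datum `hT`, Borel data on `[U(W)]`
  haveI : CompactSpace (adelicGroupData (↥(maximalRealSubfield L)) L (IsCMField.complexConj L) 2 H).automorphicQuotient :=
    (UnitaryGroup.exists_infinitePlace_ne L hdeg ι).elim fun τ hτ =>
      UnitaryGroup.compactSpace_adelicGroupData_automorphicQuotient L 2 H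
        (UnitaryGroup.anisotropic_of_formCongr_smul_eq_of_posDef L 2 H dV t ht g hg τ (hdef τ hτ))
  have hT : Continuous ιA ∧ ∀ ⦃γ : (adelicGroupData (↥(maximalRealSubfield L)) L (IsCMField.complexConj L) 2 H).Adelic⦄,
      γ ∈ (UnitaryGroup.toAdelic (↥(maximalRealSubfield L)) L (IsCMField.complexConj L) 2 H).range →
        ιA γ ∈ (UnitaryGroup.toAdelic (↥(maximalRealSubfield L)) L (IsCMField.complexConj L) 2 (Matrix.diagonal dV)).range :=
    ⟨continuous_of_pin L 2 H dV g ιA hpin, fun _ hγ => mem_range_toAdelic_of_pin L 2 H dV t ht g hg ιA hpin hγ⟩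
  letI : MeasurableSpace (↥(UnitaryGroup.adelic (↥(maximalRealSubfield L)) L (IsCMField.complexConj L) 1 (JW (↥(maximalRealSubfield L)) L a')) ⧸
      (UnitaryGroup.toAdelic (↥(maximalRealSubfield L)) L (IsCMField.complexConj L) 1 (JW (↥(maximalRealSubfield L)) L a')).range) := borel _
  haveI : BorelSpace (↥(UnitaryGroup.adelic (↥(maximalRealSubfield L)) L (IsCMField.complexConj L) 1 (JW (↥(maximalRealSubfield L)) L a')) ⧸
      (UnitaryGroup.toAdelic (↥(maximalRealSubfield L)) L (IsCMField.complexConj L) 1 (JW (↥(maximalRealSubfield L)) L a')).range) := ⟨rfl⟩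
  haveI := normal_range_toAdelic_JW L a'
  -- the mixed real place `v₀` below `ι` and its sign frame (★ (σ2)): `kp = e₁ (pP, 0)` positive, `km = e₁ (pM, 0)` non-positive
  obtain ⟨v₀, hv₀⟩ : ∃ v₀ : {v : InfinitePlace (↥(maximalRealSubfield L)) // v.IsReal},
      (InfinitePlace.mk ι).comap (algebraMap (↥(maximalRealSubfield L)) L) = v₀.1 :=
    ⟨⟨(InfinitePlace.mk ι).comap (algebraMap (↥(maximalRealSubfield L)) L), IsTotallyReal.isReal _⟩, rfl⟩
  obtain ⟨kp, km, hk, hkp, hkm⟩ := exists_signVec_pos_and_not_pos_of_sig L a' ι e₁ dV hdV hsig v₀ hv₀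
  have hi : ∀ j : Fin n', ∃ p : Fin 2, e₁ (p, 0) = j := fun j =>
    ⟨(e₁.symm j).1, by rw [show ((e₁.symm j).1, (0 : Fin 1)) = e₁.symm j from Prod.ext rfl (Subsingleton.elim _ _), Equiv.apply_symm_apply]⟩
  obtain ⟨pP, rfl⟩ := hi kp
  obtain ⟨pM, rfl⟩ := hi km
  have hp : pP ≠ pM := fun h => hk (by rw [h])
  have hcovN : ∀ p : Fin 2, p = pP ∨ p = pM := fun p =>
    (show ∀ a b c : Fin 2, a ≠ b → c = a ∨ c = b by decide) pP pM p hp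
  have hcov : ∀ k : Fin n', k = e₁ (pP, 0) ∨ k = e₁ (pM, 0) := fun k => by
    rcases eq_or_eq_of_equiv_two e₁ k with h | h
    · rcases hcovN 0 with h' | h'
      · left; rw [h, ← h']
      · right; rw [h, ← h']
    · rcases hcovN 1 with h' | h'
      · left; rw [h, ← h']
      · right; rw [h, ← h']
  -- ★ (σ1): constant sign at every real place other than `v₀`
  have hconst : ∀ v : {v : InfinitePlace (↥(maximalRealSubfield L)) // v.IsReal}, v ≠ v₀ →
      (∀ k : Fin n', 0 < signVec (cmPlaceOver L) (cmGramEntry L e₁ dV hdV (lineW L (TW (Fp L) a')) (complexConj_lineW L (TW (Fp L) a'))) (imagUnit L) v k) ∨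
      (∀ k : Fin n', ¬ 0 < signVec (cmPlaceOver L) (cmGramEntry L e₁ dV hdV (lineW L (TW (Fp L) a')) (complexConj_lineW L (TW (Fp L) a'))) (imagUnit L) v k) :=
    fun v hv => forall_signVec_pos_or_forall_not_of_ne_iota L e₁ dV hdV a' ι hdef v fun h => hv (Subtype.ext (h.symm.trans hv₀))
  -- the core ladder ★ (P5-core) §2, fed with the wrong-type vanishing ★ (P3) and the two ι-moves (hypothesis)
  exact thetaClass_follandHermite_mem_of_wrongType_zero L 2 H e₁ dV hdV hdV0 ιA hT lam hlam a' hρ μW (charCM ξ) μ t ht g hg hpin v₀ pP pM hp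
    hcovN hcov hkp hkm hconst Q Φf β
    (fun v _ hv => thetaClass_follandHermite_eq_zero_of_signedDegree_ne L 2 H e₁ dV hdV hdV0 ιA hT lam hlam a' hρ μW μ ξ Φf hne v hv)
    (fun β'' hβ'' => (hι L ι H dV hdV hdV0 t ht g hg hsig hdef hdeg μ e₁ lam hlam hw ιA hpin a' ξ hρ μW Φf v₀ hv₀ (e₁ (pP, 0)) (e₁ (pM, 0))
      hkp hkm Q β'' hβ'').1)
    (fun β'' h1 h2 hβ'' => (hι L ι H dV hdV hdV0 t ht g hg hsig hdef hdeg μ e₁ lam hlam hw ιA hpin a' ξ hρ μW Φf v₀ hv₀ (e₁ (pP, 0)) (e₁ (pM, 0))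
      hkp hkm Q β'' hβ'').2 h1 h2)
    hQ β'

end Summit.HodgeConjecture.HodgeConjecture.Cruxes.HLiu418.F0LD1ThetaArchLadder

end
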